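import Mathlib
import Summits.Ventures.PercRepro2.Defs
import Summits.Ventures.PercRepro2.Independence

/-!
# Events on pairwise disjoint edge bundles are independent; the law of a bundle state
(blind cell PercRepro2, mine-2 g15; the generic (S3) piece of the two hub theorems — MINE2-HUB.md §5 (iv),
MINE2-A3FIRST.md §3)

* `prob_biInter_eq_prod_of_dependsOn` — for pairwise disjoint edge sets `F i` and events `A i`
  determined by `F i`, `P(⋂_{i ∈ s} A i) = ∏_{i ∈ s} P(A i)` (induction on `s`, from the two-set
  independence `prob_inter_eq_mul_of_dependsOn`);
* `someOpen B` — «some edge of the bundle `B` is open»; it depends on `B` (`dependsOn_someOpen`) and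
  `P(someOpen B) = 1 − ∏_{e ∈ B} (1 − p e)` (`prob_someOpen`), by the product lemma applied to the
  closed-edge events of the (disjoint) singletons;
* `prob_bundleState_eq_prod` — for pairwise disjoint bundles `B i` and a state `w : ι → Bool`,
  `P(∀ i, [someOpen (B i)] = w i) = ∏_i q_i^{w_i} (1 − q_i)^{1 − w_i}` with `q_i = P(someOpen (B i))`
  — the root-edge law of the hub (seven bundles, `HubLaw.rootState`) and the a₃-edge law of the
  a₃-hub (four bundles, `HubLaw3.a3State`) are instances.
-/

namespace Summit.Ventures.PercRepro2.Bundles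

variable {E : Type*} [Fintype E] [DecidableEq E] {R : Type*} [CommRing R]

/-! ## The product lemma -/

omit [Fintype E] [DecidableEq E] in
/-- An intersection of events determined by sets `F i` is determined by their union. -/
lemma dependsOn_biInter {ι : Type*} (s : Finset ι) (F : ι → Set E) (A : ι → Set (Config E))
    (hA : ∀ i, DependsOn (· ∈ A i) (F i)) :
    DependsOn (· ∈ ⋂ i ∈ s, A i) (⋃ i ∈ s, F i) := by
  intro ω ω' h
  have key : ∀ i ∈ s, (ω ∈ A i) = (ω' ∈ A i) := by
    intro i hi
    exact hA i (fun e he => h e (Set.mem_iUnion₂.2 ⟨i, hi, he⟩))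
  simp only [Set.mem_iInter]
  exact propext ⟨fun hω i hi => (key i hi) ▸ hω i hi, fun hω' i hi => (key i hi).symm ▸ hω' i hi⟩

/-- **Independence over a family of pairwise disjoint edge sets**:
`P(⋂_{i ∈ s} A i) = ∏_{i ∈ s} P(A i)` when `A i` is determined by `F i`. -/
theorem prob_biInter_eq_prod_of_dependsOn (p : E → R) {ι : Type*} [DecidableEq ι] (s : Finset ι)
    (F : ι → Set E) (hF : ∀ i j, i ≠ j → Disjoint (F i) (F j)) (A : ι → Set (Config E))
    (hA : ∀ i, DependsOn (· ∈ A i) (F i)) :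
    prob p (⋂ i ∈ s, A i) = ∏ i ∈ s, prob p (A i) := by
  classical
  induction s using Finset.induction_on with
  | empty => simp [prob_univ]
  | insert a s ha ih =>
    rw [Finset.set_biInter_insert, Finset.prod_insert ha, ← ih]
    refine prob_inter_eq_mul_of_dependsOn p (F₁ := F a) (F₂ := ⋃ i ∈ s, F i) ?_ (hA a)
      (dependsOn_biInter s F A hA)
    rw [Set.disjoint_iUnion₂_right]
    intro i hi
    exact hF a i (fun h => ha (h ▸ hi))

/-! ## «Some edge of a bundle is open» -/

/-- The event that some edge of the bundle `B` is open. -/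
def someOpen (B : Finset E) : Set (Config E) := ⋃ e ∈ B, openEdge e

omit [Fintype E] [DecidableEq E] in
/-- Membership in `someOpen`. -/
lemma mem_someOpen {B : Finset E} {ω : Config E} : ω ∈ someOpen B ↔ ∃ e ∈ B, ω e = true := by
  simp [someOpen, openEdge]

omit [Fintype E] [DecidableEq E] in
/-- `someOpen B` is determined by the edges of `B`. -/
lemma dependsOn_someOpen (B : Finset E) : DependsOn (· ∈ someOpen B) (↑B : Set E) := by
  intro ω ω' h
  simp only [mem_someOpen]
  exact propext ⟨fun ⟨e, he, hω⟩ => ⟨e, he, (h e he) ▸ hω⟩, fun ⟨e, he, hω'⟩ => ⟨e, he, (h e he).symm ▸ hω'⟩⟩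

omit [Fintype E] [DecidableEq E] in
/-- The complement of `someOpen B`: every edge of `B` is closed. -/
lemma compl_someOpen (B : Finset E) : (someOpen B)ᶜ = ⋂ e ∈ B, closedEdge e := by
  ext ω
  simp [someOpen, openEdge, closedEdge]

/-- **The probability that some edge of a bundle is open**: `1 − ∏_{e ∈ B} (1 − p e)`. -/
theorem prob_someOpen (p : E → R) (B : Finset E) :
    prob p (someOpen B) = 1 - ∏ e ∈ B, (1 - p e) := by
  have h := prob_compl p (someOpen B)
  rw [compl_someOpen,
    prob_biInter_eq_prod_of_dependsOn p B (fun e => ({e} : Set E))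
      (fun i j hij => Set.disjoint_singleton.2 hij) (fun e => closedEdge e)
      (fun e => dependsOn_closedEdge e)] at h
  simp only [prob_closedEdge] at h
  linear_combination h

/-! ## The law of a bundle state -/

/-- The event `{ω | [someOpen (B i)] = w i}` for a single bundle. -/
def bundleEvent (B : Finset E) (b : Bool) : Set (Config E) :=
  if b then someOpen B else (someOpen B)ᶜ

omit [Fintype E] [DecidableEq E] in
/-- `bundleEvent` is determined by the bundle. -/
lemma dependsOn_bundleEvent (B : Finset E) (b : Bool) :
    DependsOn (· ∈ bundleEvent B b) (↑B : Set E) := by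
  cases b
  · simpa [bundleEvent] using dependsOn_compl (dependsOn_someOpen B)
  · simpa [bundleEvent] using dependsOn_someOpen B

/-- `P(bundleEvent B b) = q^b (1 − q)^{1 − b}` with `q = P(someOpen B)`. -/
lemma prob_bundleEvent (p : E → R) (B : Finset E) (b : Bool) :
    prob p (bundleEvent B b) =
      if b then prob p (someOpen B) else 1 - prob p (someOpen B) := by
  cases b
  · simp [bundleEvent, prob_compl]
  · simp [bundleEvent]

/-- **The law of a bundle state**: for pairwise disjoint bundles `B i` and a state `w`,
`P(∀ i, [someOpen (B i)] = w i) = ∏_i (if w i then q_i else 1 − q_i)`, `q_i = P(someOpen (B i))`. -/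
theorem prob_bundleState_eq_prod (p : E → R) {ι : Type*} [Fintype ι] [DecidableEq ι]
    (B : ι → Finset E) (hB : ∀ i j, i ≠ j → Disjoint (B i) (B j)) (w : ι → Bool) :
    prob p (⋂ i, bundleEvent (B i) (w i)) =
      ∏ i, (if w i then prob p (someOpen (B i)) else 1 - prob p (someOpen (B i))) := by
  classical
  have e : (⋂ i, bundleEvent (B i) (w i)) = ⋂ i ∈ (Finset.univ : Finset ι), bundleEvent (B i) (w i) := by
    simp
  rw [e, prob_biInter_eq_prod_of_dependsOn p Finset.univ (fun i => (↑(B i) : Set E))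
    (fun i j hij => Finset.disjoint_coe.2 (hB i j hij)) (fun i => bundleEvent (B i) (w i))
    (fun i => dependsOn_bundleEvent (B i) (w i))]
  refine Finset.prod_congr rfl fun i _ => ?_
  exact prob_bundleEvent p (B i) (w i)

end Summit.Ventures.PercRepro2.Bundles
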